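import Summits.BirchSwinnertonDyer.BirchSwinnertonDyer.Theorems.KatoDescentPotSupersingularWildUpperUnitTwistRecordsSharpTam10
import Summits.BirchSwinnertonDyer.BirchSwinnertonDyer.Theorems.KatoDescentPotSupersingularWildUpperUnitTwistRecordsSharpTam11
import Literature.NumberTheory.EllipticCurves.ModThreeImageCubeDiscriminantProofs
import HarnessLib

/-!
# Route `KatoDescentPotSupersingular` (rung K9, sub-rung B5 = O6 wild `p = 3`, cell `bsd-potss`): MOD-3 IMAGE KERNEL UPGRADE of the ♯
# unit-twist records on the CARTAN rows — «`ρ̄_(E,3)` NOT onto» IN THE KERNEL from `Δ(E)` being a CUBE, so that the displayed binder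
# `hns` (3-adic tower not onto) is DISCHARGED on top of the Tamagawa upgrade (part 07: 346302bx1@3, 346302n1@3, 346302b1@3, 351648l1@3, 359856ek1@3, 365040ga1@3)
# (seat `bsd-potss-k9-c4` g17; `--supports stmt-BirchSwinnertonDyer-19197 --as helper`)

HONEST FRAMING. THEOREMS ONLY (no definition, no named fact, no `sorry`); PER PAIR; nothing booked; items 19189 / 19197 / 21422 stay
OPEN class-wide; BSD is not proved for any class.  The ♯ records display `hns : ¬ ∀ n, ρ̄_(E,3ⁿ) onto` — the row's mod-3 image
type (normaliser of a split / non-split Cartan) was so far a CENSUS DATUM (conjA-anchor g9 ROW-STATUS / kmc g21), not re-derived.  On a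
Cartan row the mod-3 image has order prime to 3, so `ℚ(∛Δ) ⊂ ℚ(E[3])` (Serre 1972 §5.3) forces `Δ(E) ∈ ℚ׳`; conversely the tree
THEOREM `ModThreeImage.not_hasSurjectiveModNGaloisRep_three_of_Δ_eq_cube` (`Literature/…/ModThreeImageCubeDiscriminantProofs`, PROVED,
no named fact) gives `Δ = s³ ⟹ ρ̄_(E,3)` not surjective, hence `hns`.  Per row below: `notSurjThree_g<label>` (`Δ(E₀) = s³` for the
literal integral model, `decide +kernel` + `norm_num`) and `missingUpperBoundAt_g<label>_3_img` = the Tamagawa-upgraded record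
`missingUpperBoundAt_g<label>_3_tam` (files `…RecordsSharpTamNN`, this seat) with `hns` REMOVED as well.  After this upgrade a ♯ record's
displayed row data are: the named facts + the schema, Cremona's `N`, `r_an = 0`, the lattice-optimal datum with `3 ∤ c(D)`, the field,
and the twist numerics — the image type and the Tamagawa data are kernel facts.  (The 9-deficient rows — `GL₂(𝔽₃)` onto mod 3, tower not
onto mod 9 — are NOT covered: `Δ` is not a cube there; their `hns` stays displayed.)

References: [Serre1972] §5.3; [SilvermanAEC2009] III.1, VII.1 Rem. 1.1; [Zywina2015ModL] §1 (images of ρ̄_(E,3)); [Jetchev2008] Cor. 1.5;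
[Miller2011LMS] Def. 1.1; [Cremona2006] Table 1.
-/

set_option autoImplicit false
set_option linter.dupNamespace false
noncomputable section
open scoped Classical NumberField
open WeierstrassCurve NumberField Field
  Literature.NumberTheory.EllipticCurves
  Literature.NumberTheory.EllipticCurves.ModularForms Literature.NumberTheory.EllipticCurves.Rank1Residual
  Literature.NumberTheory.EllipticCurves.Rank1Residual.Typed Literature.NumberTheory.Automorphic
  Literature.NumberTheory.EllipticCurves.Rank1Residual.X11RankOneCertificates
  Summit.BirchSwinnertonDyer.BirchSwinnertonDyer.Rank1Residual.IntModel
  Summit.BirchSwinnertonDyer.BirchSwinnertonDyer.Rank1Residual.X11RankOne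
  Summit.BirchSwinnertonDyer.Rank1Residual Summit.BirchSwinnertonDyer.Rank1Residual.Additive
  Summit.BirchSwinnertonDyer.BirchSwinnertonDyer.Theorems

namespace Summit.BirchSwinnertonDyer.BirchSwinnertonDyer.Theorems.WildUpperUnitTwistRecords

/-! ### `346302bx1`: `Δ = -89761339391606784 = (-447744)³` — mod-3 image inside a Cartan normaliser, certified in the kernel -/

/-- **`ρ̄_(E,3)` is NOT surjective for `E = 346302bx1`** (kernel: `Δ(E) = (-447744)³` on the integral model `[1, -1, 1, 61819, -13160067]`; Serre: `ℚ(E[3]) ⊇ ℚ(μ₃, ∛Δ)`, so a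
surjective image forces `Δ ∉ ℚ׳`; tree THEOREM `ModThreeImage.not_hasSurjectiveModNGaloisRep_three_of_Δ_eq_cube`). [cite: Serre1972, §5.3]
[cite: SilvermanAEC2009, III.1] [cite: Cremona2006, Table 1 (Cremona label 346302bx1)] -/
theorem notSurjThree_g346302bx1 {W : WeierstrassCurve ℚ} [W.IsElliptic] [W.IsGloballyMinimal]
    (hI : integralModelInt W = (⟨1, -1, 1, 61819, -13160067⟩ : WeierstrassCurve ℤ)) : ¬ W.HasSurjectiveModNGaloisRep 3 := by
  have hD : discOf [1, (-1), 1, 61819, (-13160067)] = (-89761339391606784) := by decide +kernel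
  have hΔ : W.Δ = (((-89761339391606784) : ℤ) : ℚ) := by rw [Δ_eq_cast hI, intCurve_Δ, hD]
  exact ModThreeImage.not_hasSurjectiveModNGaloisRep_three_of_Δ_eq_cube W (d := (((-447744) : ℤ) : ℚ)) (by rw [hΔ]; norm_num)

/-- **RECORD `346302bx1` @ `3` with the image binder `hns` AND the Tamagawa binders DISCHARGED** — `missingUpperBoundAt_g346302bx1_3_tam` (file
`…RecordsSharpTam10`) with `hns` supplied by `notSurjThree_g346302bx1` (`n = 1`). Remaining displayed: named facts + schema, Cremona's `N`, `r_an = 0`,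
the lattice-optimal datum with `3 ∤ c(D)`, the field, the twist numerics. Per pair; nothing booked; BSD is not proved by this.
[cite: Serre1972, §5.3] [cite: Jetchev2008, Cor. 1.5] [cite: Miller2011LMS, Def. 1.1] [cite: Cremona2006, Table 1 (Cremona label 346302bx1)] -/
theorem missingUpperBoundAt_g346302bx1_3_img
    (hGZ : ∀ (N : ℕ) [NeZero N] (W : WeierstrassCurve ℚ) (K : Type) [Field K] [NumberField K],
      gross_zagier N W K)
    (hKo : ∀ (N : ℕ) [NeZero N] (W : WeierstrassCurve ℚ) (K : Type) [Field K] [NumberField K],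
      kolyvagin N W K)
    (hMN : ∀ (N : ℕ) [NeZero N] (W : WeierstrassCurve ℚ) (K : Type) [Field K] [NumberField K],
      MatarNekovar2019.thm03_padicValNat_card_sha_le_of_irreducible N W K)
    (hGZK : rank_eq_analyticRank_of_analyticRank_le_one) (hmod : hasEntireLFunction_rat)
    (hJ2 : ∀ (N : ℕ) [NeZero N] (W : WeierstrassCurve ℚ) [W.IsElliptic] [W.IsGloballyMinimal]
      (K : Type) [Field K] [NumberField K],
      IsImaginaryQuadratic K → NumberField.discr K ≠ -3 → NumberField.discr K ≠ -4 →
      SatisfiesHeegnerHypothesis N K → SatisfiesHeegnerHypothesis 2 K →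
      ∀ (p : ℕ) [Fact p.Prime], p ≠ 2 → W.analyticRank = 0 → Addv W p → 0 ≤ padicValRat p W.j →
      ¬ W.HasCM → W.HasIrreducibleModPGaloisRep p →
      ¬ (∀ n : ℕ, W.HasSurjectiveModNGaloisRep (p ^ n : ℕ)) →
      (∃ Dt : ModularParametrizationData W N,
        (∀ z ∈ Dt.L.lattice, ∃ w ∈ periodLattice Dt.f, z = (Dt.c : ℂ) * w) ∧ ¬ (p : ℤ) ∣ Dt.c) →
      ¬ p ∣ (W.baseChange ℚ_[p]).localTamagawaNumber ℤ_[p] →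
      (∀ (q' : ℕ) [Fact q'.Prime], q' ∣ N →
        p ∣ (W.baseChange ℚ_[q']).localTamagawaNumber ℤ_[q'] → ¬ q' ^ 2 ∣ N) →
      ∀ {P : (W.baseChange K).toAffine.Point}, IsHeegnerPoint N W K P → ¬ IsOfFinAddOrder P →
      ∀ (q : ℕ) [Fact q.Prime], q ∣ N → ¬ q ^ 2 ∣ N → q ≠ p →
      padicValNat p (Nat.card (AddCommGroup.primaryComponent (W.baseChange K).sha p)) +
          2 * padicValNat p ((W.baseChange ℚ_[q]).localTamagawaNumber ℤ_[q]) ≤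
        2 * padicValNat p (AddSubgroup.zmultiples P).index)
    {W : WeierstrassCurve ℚ} [W.IsElliptic] [W.IsGloballyMinimal] (hWeq : W = (⟨1, (-1), 1, 61819, (-13160067)⟩ : WeierstrassCurve ℚ))
    (hN : W.conductorNorm ℤ = 346302) (hr : W.analyticRank = 0)
    (D : ModularParametrizationData W 346302) (hopt : ∀ z ∈ D.L.lattice, ∃ w ∈ periodLattice D.f, z = (D.c : ℂ) * w)
    (hc : ¬ (3 : ℤ) ∣ D.c)
    (K : Type) [Field K] [NumberField K] (hK : IsImaginaryQuadratic K) (hdK : NumberField.discr K = -95)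
    {Wd : WeierstrassCurve ℚ} [Wd.IsElliptic] [Wd.IsGloballyMinimal] (hWdeq : Wd = (⟨1, (-1), 1, 557919295, 11269722153297⟩ : WeierstrassCurve ℚ))
    (hrd : Wd.analyticRank = 1) {qd : ℚ} (hqd : shaAn Wd = (qd : ℂ)) (hvd : padicValRat 3 qd ≤ 0) :
    MissingUpperBoundAt W 3 := by
  have hI : integralModelInt W = (⟨1, -1, 1, 61819, -13160067⟩ : WeierstrassCurve ℤ) := by
    subst hWeq; exact integralModelInt_eq_of_map_eq _ (map_mk_int 1 (-1) 1 61819 (-13160067))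
  have hns : ¬ (∀ n : ℕ, W.HasSurjectiveModNGaloisRep (3 ^ n : ℕ)) := fun h =>
    notSurjThree_g346302bx1 hI (by simpa using h 1)
  exact missingUpperBoundAt_g346302bx1_3_tam hGZ hKo hMN hGZK hmod hJ2 hWeq hN hr hns D hopt hc K hK hdK hWdeq hrd hqd hvd

/-! ### `346302n1`: `Δ = 4852834722104928768 = (1693032)³` — mod-3 image inside a Cartan normaliser, certified in the kernel -/

/-- **`ρ̄_(E,3)` is NOT surjective for `E = 346302n1`** (kernel: `Δ(E) = (1693032)³` on the integral model `[1, -1, 0, -1875462, 983348020]`; Serre: `ℚ(E[3]) ⊇ ℚ(μ₃, ∛Δ)`, so a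
surjective image forces `Δ ∉ ℚ׳`; tree THEOREM `ModThreeImage.not_hasSurjectiveModNGaloisRep_three_of_Δ_eq_cube`). [cite: Serre1972, §5.3]
[cite: SilvermanAEC2009, III.1] [cite: Cremona2006, Table 1 (Cremona label 346302n1)] -/
theorem notSurjThree_g346302n1 {W : WeierstrassCurve ℚ} [W.IsElliptic] [W.IsGloballyMinimal]
    (hI : integralModelInt W = (⟨1, -1, 0, -1875462, 983348020⟩ : WeierstrassCurve ℤ)) : ¬ W.HasSurjectiveModNGaloisRep 3 := by
  have hD : discOf [1, (-1), 0, (-1875462), 983348020] = 4852834722104928768 := by decide +kernel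
  have hΔ : W.Δ = ((4852834722104928768 : ℤ) : ℚ) := by rw [Δ_eq_cast hI, intCurve_Δ, hD]
  exact ModThreeImage.not_hasSurjectiveModNGaloisRep_three_of_Δ_eq_cube W (d := ((1693032 : ℤ) : ℚ)) (by rw [hΔ]; norm_num)

/-- **RECORD `346302n1` @ `3` with the image binder `hns` AND the Tamagawa binders DISCHARGED** — `missingUpperBoundAt_g346302n1_3_tam` (file
`…RecordsSharpTam10`) with `hns` supplied by `notSurjThree_g346302n1` (`n = 1`). Remaining displayed: named facts + schema, Cremona's `N`, `r_an = 0`,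
the lattice-optimal datum with `3 ∤ c(D)`, the field, the twist numerics. Per pair; nothing booked; BSD is not proved by this.
[cite: Serre1972, §5.3] [cite: Jetchev2008, Cor. 1.5] [cite: Miller2011LMS, Def. 1.1] [cite: Cremona2006, Table 1 (Cremona label 346302n1)] -/
theorem missingUpperBoundAt_g346302n1_3_img
    (hGZ : ∀ (N : ℕ) [NeZero N] (W : WeierstrassCurve ℚ) (K : Type) [Field K] [NumberField K],
      gross_zagier N W K)
    (hKo : ∀ (N : ℕ) [NeZero N] (W : WeierstrassCurve ℚ) (K : Type) [Field K] [NumberField K],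
      kolyvagin N W K)
    (hMN : ∀ (N : ℕ) [NeZero N] (W : WeierstrassCurve ℚ) (K : Type) [Field K] [NumberField K],
      MatarNekovar2019.thm03_padicValNat_card_sha_le_of_irreducible N W K)
    (hGZK : rank_eq_analyticRank_of_analyticRank_le_one) (hmod : hasEntireLFunction_rat)
    (hJ2 : ∀ (N : ℕ) [NeZero N] (W : WeierstrassCurve ℚ) [W.IsElliptic] [W.IsGloballyMinimal]
      (K : Type) [Field K] [NumberField K],
      IsImaginaryQuadratic K → NumberField.discr K ≠ -3 → NumberField.discr K ≠ -4 →
      SatisfiesHeegnerHypothesis N K → SatisfiesHeegnerHypothesis 2 K →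
      ∀ (p : ℕ) [Fact p.Prime], p ≠ 2 → W.analyticRank = 0 → Addv W p → 0 ≤ padicValRat p W.j →
      ¬ W.HasCM → W.HasIrreducibleModPGaloisRep p →
      ¬ (∀ n : ℕ, W.HasSurjectiveModNGaloisRep (p ^ n : ℕ)) →
      (∃ Dt : ModularParametrizationData W N,
        (∀ z ∈ Dt.L.lattice, ∃ w ∈ periodLattice Dt.f, z = (Dt.c : ℂ) * w) ∧ ¬ (p : ℤ) ∣ Dt.c) →
      ¬ p ∣ (W.baseChange ℚ_[p]).localTamagawaNumber ℤ_[p] →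
      (∀ (q' : ℕ) [Fact q'.Prime], q' ∣ N →
        p ∣ (W.baseChange ℚ_[q']).localTamagawaNumber ℤ_[q'] → ¬ q' ^ 2 ∣ N) →
      ∀ {P : (W.baseChange K).toAffine.Point}, IsHeegnerPoint N W K P → ¬ IsOfFinAddOrder P →
      ∀ (q : ℕ) [Fact q.Prime], q ∣ N → ¬ q ^ 2 ∣ N → q ≠ p →
      padicValNat p (Nat.card (AddCommGroup.primaryComponent (W.baseChange K).sha p)) +
          2 * padicValNat p ((W.baseChange ℚ_[q]).localTamagawaNumber ℤ_[q]) ≤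
        2 * padicValNat p (AddSubgroup.zmultiples P).index)
    {W : WeierstrassCurve ℚ} [W.IsElliptic] [W.IsGloballyMinimal] (hWeq : W = (⟨1, (-1), 0, (-1875462), 983348020⟩ : WeierstrassCurve ℚ))
    (hN : W.conductorNorm ℤ = 346302) (hr : W.analyticRank = 0)
    (D : ModularParametrizationData W 346302) (hopt : ∀ z ∈ D.L.lattice, ∃ w ∈ periodLattice D.f, z = (D.c : ℂ) * w)
    (hc : ¬ (3 : ℤ) ∣ D.c)
    (K : Type) [Field K] [NumberField K] (hK : IsImaginaryQuadratic K) (hdK : NumberField.discr K = -95)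
    {Wd : WeierstrassCurve ℚ} [Wd.IsElliptic] [Wd.IsGloballyMinimal] (hWdeq : Wd = (⟨1, (-1), 0, (-16926046242), (-842691783551084)⟩ : WeierstrassCurve ℚ))
    (hrd : Wd.analyticRank = 1) {qd : ℚ} (hqd : shaAn Wd = (qd : ℂ)) (hvd : padicValRat 3 qd ≤ 0) :
    MissingUpperBoundAt W 3 := by
  have hI : integralModelInt W = (⟨1, -1, 0, -1875462, 983348020⟩ : WeierstrassCurve ℤ) := by
    subst hWeq; exact integralModelInt_eq_of_map_eq _ (map_mk_int 1 (-1) 0 (-1875462) 983348020)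
  have hns : ¬ (∀ n : ℕ, W.HasSurjectiveModNGaloisRep (3 ^ n : ℕ)) := fun h =>
    notSurjThree_g346302n1 hI (by simpa using h 1)
  exact missingUpperBoundAt_g346302n1_3_tam hGZ hKo hMN hGZK hmod hJ2 hWeq hN hr hns D hopt hc K hK hdK hWdeq hrd hqd hvd

/-! ### `346302b1`: `Δ = -65436016416481345536 = (-4029696)³` — mod-3 image inside a Cartan normaliser, certified in the kernel -/

/-- **`ρ̄_(E,3)` is NOT surjective for `E = 346302b1`** (kernel: `Δ(E) = (-4029696)³` on the integral model `[1, -1, 0, 556374, 354765428]`; Serre: `ℚ(E[3]) ⊇ ℚ(μ₃, ∛Δ)`, so a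
surjective image forces `Δ ∉ ℚ׳`; tree THEOREM `ModThreeImage.not_hasSurjectiveModNGaloisRep_three_of_Δ_eq_cube`). [cite: Serre1972, §5.3]
[cite: SilvermanAEC2009, III.1] [cite: Cremona2006, Table 1 (Cremona label 346302b1)] -/
theorem notSurjThree_g346302b1 {W : WeierstrassCurve ℚ} [W.IsElliptic] [W.IsGloballyMinimal]
    (hI : integralModelInt W = (⟨1, -1, 0, 556374, 354765428⟩ : WeierstrassCurve ℤ)) : ¬ W.HasSurjectiveModNGaloisRep 3 := by
  have hD : discOf [1, (-1), 0, 556374, 354765428] = (-65436016416481345536) := by decide +kernel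
  have hΔ : W.Δ = (((-65436016416481345536) : ℤ) : ℚ) := by rw [Δ_eq_cast hI, intCurve_Δ, hD]
  exact ModThreeImage.not_hasSurjectiveModNGaloisRep_three_of_Δ_eq_cube W (d := (((-4029696) : ℤ) : ℚ)) (by rw [hΔ]; norm_num)

/-- **RECORD `346302b1` @ `3` with the image binder `hns` AND the Tamagawa binders DISCHARGED** — `missingUpperBoundAt_g346302b1_3_tam` (file
`…RecordsSharpTam10`) with `hns` supplied by `notSurjThree_g346302b1` (`n = 1`). Remaining displayed: named facts + schema, Cremona's `N`, `r_an = 0`,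
the lattice-optimal datum with `3 ∤ c(D)`, the field, the twist numerics. Per pair; nothing booked; BSD is not proved by this.
[cite: Serre1972, §5.3] [cite: Jetchev2008, Cor. 1.5] [cite: Miller2011LMS, Def. 1.1] [cite: Cremona2006, Table 1 (Cremona label 346302b1)] -/
theorem missingUpperBoundAt_g346302b1_3_img
    (hGZ : ∀ (N : ℕ) [NeZero N] (W : WeierstrassCurve ℚ) (K : Type) [Field K] [NumberField K],
      gross_zagier N W K)
    (hKo : ∀ (N : ℕ) [NeZero N] (W : WeierstrassCurve ℚ) (K : Type) [Field K] [NumberField K],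
      kolyvagin N W K)
    (hMN : ∀ (N : ℕ) [NeZero N] (W : WeierstrassCurve ℚ) (K : Type) [Field K] [NumberField K],
      MatarNekovar2019.thm03_padicValNat_card_sha_le_of_irreducible N W K)
    (hGZK : rank_eq_analyticRank_of_analyticRank_le_one) (hmod : hasEntireLFunction_rat)
    (hJ2 : ∀ (N : ℕ) [NeZero N] (W : WeierstrassCurve ℚ) [W.IsElliptic] [W.IsGloballyMinimal]
      (K : Type) [Field K] [NumberField K],
      IsImaginaryQuadratic K → NumberField.discr K ≠ -3 → NumberField.discr K ≠ -4 →
      SatisfiesHeegnerHypothesis N K → SatisfiesHeegnerHypothesis 2 K →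
      ∀ (p : ℕ) [Fact p.Prime], p ≠ 2 → W.analyticRank = 0 → Addv W p → 0 ≤ padicValRat p W.j →
      ¬ W.HasCM → W.HasIrreducibleModPGaloisRep p →
      ¬ (∀ n : ℕ, W.HasSurjectiveModNGaloisRep (p ^ n : ℕ)) →
      (∃ Dt : ModularParametrizationData W N,
        (∀ z ∈ Dt.L.lattice, ∃ w ∈ periodLattice Dt.f, z = (Dt.c : ℂ) * w) ∧ ¬ (p : ℤ) ∣ Dt.c) →
      ¬ p ∣ (W.baseChange ℚ_[p]).localTamagawaNumber ℤ_[p] →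
      (∀ (q' : ℕ) [Fact q'.Prime], q' ∣ N →
        p ∣ (W.baseChange ℚ_[q']).localTamagawaNumber ℤ_[q'] → ¬ q' ^ 2 ∣ N) →
      ∀ {P : (W.baseChange K).toAffine.Point}, IsHeegnerPoint N W K P → ¬ IsOfFinAddOrder P →
      ∀ (q : ℕ) [Fact q.Prime], q ∣ N → ¬ q ^ 2 ∣ N → q ≠ p →
      padicValNat p (Nat.card (AddCommGroup.primaryComponent (W.baseChange K).sha p)) +
          2 * padicValNat p ((W.baseChange ℚ_[q]).localTamagawaNumber ℤ_[q]) ≤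
        2 * padicValNat p (AddSubgroup.zmultiples P).index)
    {W : WeierstrassCurve ℚ} [W.IsElliptic] [W.IsGloballyMinimal] (hWeq : W = (⟨1, (-1), 0, 556374, 354765428⟩ : WeierstrassCurve ℚ))
    (hN : W.conductorNorm ℤ = 346302) (hr : W.analyticRank = 0)
    (D : ModularParametrizationData W 346302) (hopt : ∀ z ∈ D.L.lattice, ∃ w ∈ periodLattice D.f, z = (D.c : ℂ) * w)
    (hc : ¬ (3 : ℤ) ∣ D.c)
    (K : Type) [Field K] [NumberField K] (hK : IsImaginaryQuadratic K) (hdK : NumberField.discr K = -95)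
    {Wd : WeierstrassCurve ℚ} [Wd.IsElliptic] [Wd.IsGloballyMinimal] (hWdeq : Wd = (⟨1, (-1), 0, 5021273658, (-304287519412684)⟩ : WeierstrassCurve ℚ))
    (hrd : Wd.analyticRank = 1) {qd : ℚ} (hqd : shaAn Wd = (qd : ℂ)) (hvd : padicValRat 3 qd ≤ 0) :
    MissingUpperBoundAt W 3 := by
  have hI : integralModelInt W = (⟨1, -1, 0, 556374, 354765428⟩ : WeierstrassCurve ℤ) := by
    subst hWeq; exact integralModelInt_eq_of_map_eq _ (map_mk_int 1 (-1) 0 556374 354765428)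
  have hns : ¬ (∀ n : ℕ, W.HasSurjectiveModNGaloisRep (3 ^ n : ℕ)) := fun h =>
    notSurjThree_g346302b1 hI (by simpa using h 1)
  exact missingUpperBoundAt_g346302b1_3_tam hGZ hKo hMN hGZK hmod hJ2 hWeq hN hr hns D hopt hc K hK hdK hWdeq hrd hqd hvd

/-! ### `351648l1`: `Δ = -155061871487424 = (-53724)³` — mod-3 image inside a Cartan normaliser, certified in the kernel -/

/-- **`ρ̄_(E,3)` is NOT surjective for `E = 351648l1`** (kernel: `Δ(E) = (-53724)³` on the integral model `[0, 0, 0, 11127, -393504]`; Serre: `ℚ(E[3]) ⊇ ℚ(μ₃, ∛Δ)`, so a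
surjective image forces `Δ ∉ ℚ׳`; tree THEOREM `ModThreeImage.not_hasSurjectiveModNGaloisRep_three_of_Δ_eq_cube`). [cite: Serre1972, §5.3]
[cite: SilvermanAEC2009, III.1] [cite: Cremona2006, Table 1 (Cremona label 351648l1)] -/
theorem notSurjThree_g351648l1 {W : WeierstrassCurve ℚ} [W.IsElliptic] [W.IsGloballyMinimal]
    (hI : integralModelInt W = (⟨0, 0, 0, 11127, -393504⟩ : WeierstrassCurve ℤ)) : ¬ W.HasSurjectiveModNGaloisRep 3 := by
  have hD : discOf [0, 0, 0, 11127, (-393504)] = (-155061871487424) := by decide +kernel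
  have hΔ : W.Δ = (((-155061871487424) : ℤ) : ℚ) := by rw [Δ_eq_cast hI, intCurve_Δ, hD]
  exact ModThreeImage.not_hasSurjectiveModNGaloisRep_three_of_Δ_eq_cube W (d := (((-53724) : ℤ) : ℚ)) (by rw [hΔ]; norm_num)

/-- **RECORD `351648l1` @ `3` with the image binder `hns` AND the Tamagawa binders DISCHARGED** — `missingUpperBoundAt_g351648l1_3_tam` (file
`…RecordsSharpTam10`) with `hns` supplied by `notSurjThree_g351648l1` (`n = 1`). Remaining displayed: named facts + schema, Cremona's `N`, `r_an = 0`,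
the lattice-optimal datum with `3 ∤ c(D)`, the field, the twist numerics. Per pair; nothing booked; BSD is not proved by this.
[cite: Serre1972, §5.3] [cite: Jetchev2008, Cor. 1.5] [cite: Miller2011LMS, Def. 1.1] [cite: Cremona2006, Table 1 (Cremona label 351648l1)] -/
theorem missingUpperBoundAt_g351648l1_3_img
    (hGZ : ∀ (N : ℕ) [NeZero N] (W : WeierstrassCurve ℚ) (K : Type) [Field K] [NumberField K],
      gross_zagier N W K)
    (hKo : ∀ (N : ℕ) [NeZero N] (W : WeierstrassCurve ℚ) (K : Type) [Field K] [NumberField K],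
      kolyvagin N W K)
    (hMN : ∀ (N : ℕ) [NeZero N] (W : WeierstrassCurve ℚ) (K : Type) [Field K] [NumberField K],
      MatarNekovar2019.thm03_padicValNat_card_sha_le_of_irreducible N W K)
    (hGZK : rank_eq_analyticRank_of_analyticRank_le_one) (hmod : hasEntireLFunction_rat)
    (hJ2 : ∀ (N : ℕ) [NeZero N] (W : WeierstrassCurve ℚ) [W.IsElliptic] [W.IsGloballyMinimal]
      (K : Type) [Field K] [NumberField K],
      IsImaginaryQuadratic K → NumberField.discr K ≠ -3 → NumberField.discr K ≠ -4 →
      SatisfiesHeegnerHypothesis N K → SatisfiesHeegnerHypothesis 2 K →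
      ∀ (p : ℕ) [Fact p.Prime], p ≠ 2 → W.analyticRank = 0 → Addv W p → 0 ≤ padicValRat p W.j →
      ¬ W.HasCM → W.HasIrreducibleModPGaloisRep p →
      ¬ (∀ n : ℕ, W.HasSurjectiveModNGaloisRep (p ^ n : ℕ)) →
      (∃ Dt : ModularParametrizationData W N,
        (∀ z ∈ Dt.L.lattice, ∃ w ∈ periodLattice Dt.f, z = (Dt.c : ℂ) * w) ∧ ¬ (p : ℤ) ∣ Dt.c) →
      ¬ p ∣ (W.baseChange ℚ_[p]).localTamagawaNumber ℤ_[p] →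
      (∀ (q' : ℕ) [Fact q'.Prime], q' ∣ N →
        p ∣ (W.baseChange ℚ_[q']).localTamagawaNumber ℤ_[q'] → ¬ q' ^ 2 ∣ N) →
      ∀ {P : (W.baseChange K).toAffine.Point}, IsHeegnerPoint N W K P → ¬ IsOfFinAddOrder P →
      ∀ (q : ℕ) [Fact q.Prime], q ∣ N → ¬ q ^ 2 ∣ N → q ≠ p →
      padicValNat p (Nat.card (AddCommGroup.primaryComponent (W.baseChange K).sha p)) +
          2 * padicValNat p ((W.baseChange ℚ_[q]).localTamagawaNumber ℤ_[q]) ≤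
        2 * padicValNat p (AddSubgroup.zmultiples P).index)
    {W : WeierstrassCurve ℚ} [W.IsElliptic] [W.IsGloballyMinimal] (hWeq : W = (⟨0, 0, 0, 11127, (-393504)⟩ : WeierstrassCurve ℚ))
    (hN : W.conductorNorm ℤ = 351648) (hr : W.analyticRank = 0)
    (D : ModularParametrizationData W 351648) (hopt : ∀ z ∈ D.L.lattice, ∃ w ∈ periodLattice D.f, z = (D.c : ℂ) * w)
    (hc : ¬ (3 : ℤ) ∣ D.c)
    (K : Type) [Field K] [NumberField K] (hK : IsImaginaryQuadratic K) (hdK : NumberField.discr K = -95)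
    {Wd : WeierstrassCurve ℚ} [Wd.IsElliptic] [Wd.IsGloballyMinimal] (hWdeq : Wd = (⟨0, 0, 0, 100421175, 337380492000⟩ : WeierstrassCurve ℚ))
    (hrd : Wd.analyticRank = 1) {qd : ℚ} (hqd : shaAn Wd = (qd : ℂ)) (hvd : padicValRat 3 qd ≤ 0) :
    MissingUpperBoundAt W 3 := by
  have hI : integralModelInt W = (⟨0, 0, 0, 11127, -393504⟩ : WeierstrassCurve ℤ) := by
    subst hWeq; exact integralModelInt_eq_of_map_eq _ (map_mk_int 0 0 0 11127 (-393504))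
  have hns : ¬ (∀ n : ℕ, W.HasSurjectiveModNGaloisRep (3 ^ n : ℕ)) := fun h =>
    notSurjThree_g351648l1 hI (by simpa using h 1)
  exact missingUpperBoundAt_g351648l1_3_tam hGZ hKo hMN hGZK hmod hJ2 hWeq hN hr hns D hopt hc K hK hdK hWdeq hrd hqd hvd

/-! ### `359856ek1`: `Δ = 21925668135555072 = (279888)³` — mod-3 image inside a Cartan normaliser, certified in the kernel -/

/-- **`ρ̄_(E,3)` is NOT surjective for `E = 359856ek1`** (kernel: `Δ(E) = (279888)³` on the integral model `[0, 0, 0, -82320, 5647152]`; Serre: `ℚ(E[3]) ⊇ ℚ(μ₃, ∛Δ)`, so a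
surjective image forces `Δ ∉ ℚ׳`; tree THEOREM `ModThreeImage.not_hasSurjectiveModNGaloisRep_three_of_Δ_eq_cube`). [cite: Serre1972, §5.3]
[cite: SilvermanAEC2009, III.1] [cite: Cremona2006, Table 1 (Cremona label 359856ek1)] -/
theorem notSurjThree_g359856ek1 {W : WeierstrassCurve ℚ} [W.IsElliptic] [W.IsGloballyMinimal]
    (hI : integralModelInt W = (⟨0, 0, 0, -82320, 5647152⟩ : WeierstrassCurve ℤ)) : ¬ W.HasSurjectiveModNGaloisRep 3 := by
  have hD : discOf [0, 0, 0, (-82320), 5647152] = 21925668135555072 := by decide +kernel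
  have hΔ : W.Δ = ((21925668135555072 : ℤ) : ℚ) := by rw [Δ_eq_cast hI, intCurve_Δ, hD]
  exact ModThreeImage.not_hasSurjectiveModNGaloisRep_three_of_Δ_eq_cube W (d := ((279888 : ℤ) : ℚ)) (by rw [hΔ]; norm_num)

/-- **RECORD `359856ek1` @ `3` with the image binder `hns` AND the Tamagawa binders DISCHARGED** — `missingUpperBoundAt_g359856ek1_3_tam` (file
`…RecordsSharpTam11`) with `hns` supplied by `notSurjThree_g359856ek1` (`n = 1`). Remaining displayed: named facts + schema, Cremona's `N`, `r_an = 0`,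
the lattice-optimal datum with `3 ∤ c(D)`, the field, the twist numerics. Per pair; nothing booked; BSD is not proved by this.
[cite: Serre1972, §5.3] [cite: Jetchev2008, Cor. 1.5] [cite: Miller2011LMS, Def. 1.1] [cite: Cremona2006, Table 1 (Cremona label 359856ek1)] -/
theorem missingUpperBoundAt_g359856ek1_3_img
    (hGZ : ∀ (N : ℕ) [NeZero N] (W : WeierstrassCurve ℚ) (K : Type) [Field K] [NumberField K],
      gross_zagier N W K)
    (hKo : ∀ (N : ℕ) [NeZero N] (W : WeierstrassCurve ℚ) (K : Type) [Field K] [NumberField K],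
      kolyvagin N W K)
    (hMN : ∀ (N : ℕ) [NeZero N] (W : WeierstrassCurve ℚ) (K : Type) [Field K] [NumberField K],
      MatarNekovar2019.thm03_padicValNat_card_sha_le_of_irreducible N W K)
    (hGZK : rank_eq_analyticRank_of_analyticRank_le_one) (hmod : hasEntireLFunction_rat)
    (hJ2 : ∀ (N : ℕ) [NeZero N] (W : WeierstrassCurve ℚ) [W.IsElliptic] [W.IsGloballyMinimal]
      (K : Type) [Field K] [NumberField K],
      IsImaginaryQuadratic K → NumberField.discr K ≠ -3 → NumberField.discr K ≠ -4 →
      SatisfiesHeegnerHypothesis N K → SatisfiesHeegnerHypothesis 2 K →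
      ∀ (p : ℕ) [Fact p.Prime], p ≠ 2 → W.analyticRank = 0 → Addv W p → 0 ≤ padicValRat p W.j →
      ¬ W.HasCM → W.HasIrreducibleModPGaloisRep p →
      ¬ (∀ n : ℕ, W.HasSurjectiveModNGaloisRep (p ^ n : ℕ)) →
      (∃ Dt : ModularParametrizationData W N,
        (∀ z ∈ Dt.L.lattice, ∃ w ∈ periodLattice Dt.f, z = (Dt.c : ℂ) * w) ∧ ¬ (p : ℤ) ∣ Dt.c) →
      ¬ p ∣ (W.baseChange ℚ_[p]).localTamagawaNumber ℤ_[p] →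
      (∀ (q' : ℕ) [Fact q'.Prime], q' ∣ N →
        p ∣ (W.baseChange ℚ_[q']).localTamagawaNumber ℤ_[q'] → ¬ q' ^ 2 ∣ N) →
      ∀ {P : (W.baseChange K).toAffine.Point}, IsHeegnerPoint N W K P → ¬ IsOfFinAddOrder P →
      ∀ (q : ℕ) [Fact q.Prime], q ∣ N → ¬ q ^ 2 ∣ N → q ≠ p →
      padicValNat p (Nat.card (AddCommGroup.primaryComponent (W.baseChange K).sha p)) +
          2 * padicValNat p ((W.baseChange ℚ_[q]).localTamagawaNumber ℤ_[q]) ≤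
        2 * padicValNat p (AddSubgroup.zmultiples P).index)
    {W : WeierstrassCurve ℚ} [W.IsElliptic] [W.IsGloballyMinimal] (hWeq : W = (⟨0, 0, 0, (-82320), 5647152⟩ : WeierstrassCurve ℚ))
    (hN : W.conductorNorm ℤ = 359856) (hr : W.analyticRank = 0)
    (D : ModularParametrizationData W 359856) (hopt : ∀ z ∈ D.L.lattice, ∃ w ∈ periodLattice D.f, z = (D.c : ℂ) * w)
    (hc : ¬ (3 : ℤ) ∣ D.c)
    (K : Type) [Field K] [NumberField K] (hK : IsImaginaryQuadratic K) (hdK : NumberField.discr K = -47)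
    {Wd : WeierstrassCurve ℚ} [Wd.IsElliptic] [Wd.IsGloballyMinimal] (hWdeq : Wd = (⟨0, 0, 0, (-181844880), (-586304262096)⟩ : WeierstrassCurve ℚ))
    (hrd : Wd.analyticRank = 1) {qd : ℚ} (hqd : shaAn Wd = (qd : ℂ)) (hvd : padicValRat 3 qd ≤ 0) :
    MissingUpperBoundAt W 3 := by
  have hI : integralModelInt W = (⟨0, 0, 0, -82320, 5647152⟩ : WeierstrassCurve ℤ) := by
    subst hWeq; exact integralModelInt_eq_of_map_eq _ (map_mk_int 0 0 0 (-82320) 5647152)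
  have hns : ¬ (∀ n : ℕ, W.HasSurjectiveModNGaloisRep (3 ^ n : ℕ)) := fun h =>
    notSurjThree_g359856ek1 hI (by simpa using h 1)
  exact missingUpperBoundAt_g359856ek1_3_tam hGZ hKo hMN hGZK hmod hJ2 hWeq hN hr hns D hopt hc K hK hdK hWdeq hrd hqd hvd

/-! ### `365040ga1`: `Δ = -146596599332352000 = (-527280)³` — mod-3 image inside a Cartan normaliser, certified in the kernel -/

/-- **`ρ̄_(E,3)` is NOT surjective for `E = 365040ga1`** (kernel: `Δ(E) = (-527280)³` on the integral model `[0, 0, 0, -210912, 41584816]`; Serre: `ℚ(E[3]) ⊇ ℚ(μ₃, ∛Δ)`, so a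
surjective image forces `Δ ∉ ℚ׳`; tree THEOREM `ModThreeImage.not_hasSurjectiveModNGaloisRep_three_of_Δ_eq_cube`). [cite: Serre1972, §5.3]
[cite: SilvermanAEC2009, III.1] [cite: Cremona2006, Table 1 (Cremona label 365040ga1)] -/
theorem notSurjThree_g365040ga1 {W : WeierstrassCurve ℚ} [W.IsElliptic] [W.IsGloballyMinimal]
    (hI : integralModelInt W = (⟨0, 0, 0, -210912, 41584816⟩ : WeierstrassCurve ℤ)) : ¬ W.HasSurjectiveModNGaloisRep 3 := by
  have hD : discOf [0, 0, 0, (-210912), 41584816] = (-146596599332352000) := by decide +kernel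
  have hΔ : W.Δ = (((-146596599332352000) : ℤ) : ℚ) := by rw [Δ_eq_cast hI, intCurve_Δ, hD]
  exact ModThreeImage.not_hasSurjectiveModNGaloisRep_three_of_Δ_eq_cube W (d := (((-527280) : ℤ) : ℚ)) (by rw [hΔ]; norm_num)

/-- **RECORD `365040ga1` @ `3` with the image binder `hns` AND the Tamagawa binders DISCHARGED** — `missingUpperBoundAt_g365040ga1_3_tam` (file
`…RecordsSharpTam11`) with `hns` supplied by `notSurjThree_g365040ga1` (`n = 1`). Remaining displayed: named facts + schema, Cremona's `N`, `r_an = 0`,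
the lattice-optimal datum with `3 ∤ c(D)`, the field, the twist numerics. Per pair; nothing booked; BSD is not proved by this.
[cite: Serre1972, §5.3] [cite: Jetchev2008, Cor. 1.5] [cite: Miller2011LMS, Def. 1.1] [cite: Cremona2006, Table 1 (Cremona label 365040ga1)] -/
theorem missingUpperBoundAt_g365040ga1_3_img
    (hGZ : ∀ (N : ℕ) [NeZero N] (W : WeierstrassCurve ℚ) (K : Type) [Field K] [NumberField K],
      gross_zagier N W K)
    (hKo : ∀ (N : ℕ) [NeZero N] (W : WeierstrassCurve ℚ) (K : Type) [Field K] [NumberField K],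
      kolyvagin N W K)
    (hMN : ∀ (N : ℕ) [NeZero N] (W : WeierstrassCurve ℚ) (K : Type) [Field K] [NumberField K],
      MatarNekovar2019.thm03_padicValNat_card_sha_le_of_irreducible N W K)
    (hGZK : rank_eq_analyticRank_of_analyticRank_le_one) (hmod : hasEntireLFunction_rat)
    (hJ2 : ∀ (N : ℕ) [NeZero N] (W : WeierstrassCurve ℚ) [W.IsElliptic] [W.IsGloballyMinimal]
      (K : Type) [Field K] [NumberField K],
      IsImaginaryQuadratic K → NumberField.discr K ≠ -3 → NumberField.discr K ≠ -4 →
      SatisfiesHeegnerHypothesis N K → SatisfiesHeegnerHypothesis 2 K →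
      ∀ (p : ℕ) [Fact p.Prime], p ≠ 2 → W.analyticRank = 0 → Addv W p → 0 ≤ padicValRat p W.j →
      ¬ W.HasCM → W.HasIrreducibleModPGaloisRep p →
      ¬ (∀ n : ℕ, W.HasSurjectiveModNGaloisRep (p ^ n : ℕ)) →
      (∃ Dt : ModularParametrizationData W N,
        (∀ z ∈ Dt.L.lattice, ∃ w ∈ periodLattice Dt.f, z = (Dt.c : ℂ) * w) ∧ ¬ (p : ℤ) ∣ Dt.c) →
      ¬ p ∣ (W.baseChange ℚ_[p]).localTamagawaNumber ℤ_[p] →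
      (∀ (q' : ℕ) [Fact q'.Prime], q' ∣ N →
        p ∣ (W.baseChange ℚ_[q']).localTamagawaNumber ℤ_[q'] → ¬ q' ^ 2 ∣ N) →
      ∀ {P : (W.baseChange K).toAffine.Point}, IsHeegnerPoint N W K P → ¬ IsOfFinAddOrder P →
      ∀ (q : ℕ) [Fact q.Prime], q ∣ N → ¬ q ^ 2 ∣ N → q ≠ p →
      padicValNat p (Nat.card (AddCommGroup.primaryComponent (W.baseChange K).sha p)) +
          2 * padicValNat p ((W.baseChange ℚ_[q]).localTamagawaNumber ℤ_[q]) ≤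
        2 * padicValNat p (AddSubgroup.zmultiples P).index)
    {W : WeierstrassCurve ℚ} [W.IsElliptic] [W.IsGloballyMinimal] (hWeq : W = (⟨0, 0, 0, (-210912), 41584816⟩ : WeierstrassCurve ℚ))
    (hN : W.conductorNorm ℤ = 365040) (hr : W.analyticRank = 0)
    (D : ModularParametrizationData W 365040) (hopt : ∀ z ∈ D.L.lattice, ∃ w ∈ periodLattice D.f, z = (D.c : ℂ) * w)
    (hc : ¬ (3 : ℤ) ∣ D.c)
    (K : Type) [Field K] [NumberField K] (hK : IsImaginaryQuadratic K) (hdK : NumberField.discr K = -599)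
    {Wd : WeierstrassCurve ℚ} [Wd.IsElliptic] [Wd.IsGloballyMinimal] (hWdeq : Wd = (⟨0, 0, 0, (-75675436512), (-8937483465803984)⟩ : WeierstrassCurve ℚ))
    (hrd : Wd.analyticRank = 1) {qd : ℚ} (hqd : shaAn Wd = (qd : ℂ)) (hvd : padicValRat 3 qd ≤ 0) :
    MissingUpperBoundAt W 3 := by
  have hI : integralModelInt W = (⟨0, 0, 0, -210912, 41584816⟩ : WeierstrassCurve ℤ) := by
    subst hWeq; exact integralModelInt_eq_of_map_eq _ (map_mk_int 0 0 0 (-210912) 41584816)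
  have hns : ¬ (∀ n : ℕ, W.HasSurjectiveModNGaloisRep (3 ^ n : ℕ)) := fun h =>
    notSurjThree_g365040ga1 hI (by simpa using h 1)
  exact missingUpperBoundAt_g365040ga1_3_tam hGZ hKo hMN hGZK hmod hJ2 hWeq hN hr hns D hopt hc K hK hdK hWdeq hrd hqd hvd

end Summit.BirchSwinnertonDyer.BirchSwinnertonDyer.Theorems.WildUpperUnitTwistRecords

end
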